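import Summits.QuantumFields.BalabanUV.T4Continuum.Support.TorusSmallFieldGlobalGaugeSharp
import Summits.QuantumFields.BalabanUV.T4Continuum.Support.MinimalActionCompact
import Mathlib.Analysis.Normed.Algebra.MatrixExponential
import HarnessLib

/-!
# NE7NearFlatSharpSector — THE ABELIAN FLUX IS CONSTANT ALONG PATHS: the unit-flux datum (`2π∕N²`-small) is NOT joined to ANY flat datum by a continuous path of
# `N`-periodic configurations whose `(0,1)`-plaquette variables stay within distance `< 1` of the identity — so NO continuation-from-flat method (along small
# paths OR through nearby flat data) reaches data radius `2π∕N²`: uniformity of `δ_V` in the torus size needs print's LOCAL existence theorem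

Cell `pub-balaban`, rung (B)+1 sub-cell t4, lineage `b2b-balaban-t4-ne7b-p1` (row NE7b OWNER + CRUX PROVER), generation 157; junction census for the NE7 road's
located gap (G1) of `t4/b2b-balaban-t4-ne7-p1-g113/ROAD-G113.md` §6 (data radius uniform in the torus size), part 4 — the complement of parts 2∕3
(`NE7NearFlatSharpAbelian`, `NE7NearFlatSharpHolonomy`: the METRIC rate of «near flat» is `≍ N·γ` and `≳ √γ∕N`; their witnesses lie on small-curvature paths)
for the PATH mechanism F28 `NE7OneStepOfSectorApeRep.oneStep_of_path_ape_repWgauge` (a continuous path `γ : [0,1] → data` from a datum with a flat lift).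
THE ARGUMENT ([folklore]).  For an `N`-periodic configuration `V` with invertible bonds whose `(0,1)`-plaquette variables `P_x` on the slice `x = (a, b, 0, 0)`,
`a, b < N`, are within `1` of the identity, the «det-flux» `Φ(V) = Σ_{a,b<N} tr mlog P_{(a,b,0,0)}` satisfies `exp Φ(V) = Π det P_x = 1` (every bond determinant
enters once forward, once backward: periodic telescoping), so `Φ(V) ∈ 2πi·ℤ`; `Φ` is continuous along any path in that domain (`MatrixLog.analyticAt_mlog`,
`MinimalActionCompact.continuous_val_hol`); `Φ = 0` at a flat configuration and `Φ = 2πi` at gen 156's unit-flux configuration (`plaqPhase_zero_one`: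
`tr mlog D(e^{2πi∕N²}) = 2πi∕N²`, `N ≥ 4`).  An integer-valued continuous function on `[0,1]` is constant (intermediate value): contradiction.
WHAT ([folklore]; 0 def, 0 sorry).  §1 `prod_range_mul_inv_telescope`; `det_val_hol_plaqWord` (the plaquette determinant as a product of four bond determinants);
**`cexp_fluxSum_eq_one`** (periodic telescoping); `fluxSum_mem_zmultiples`; §2 `continuousOn_fluxSum` (along a path with `(0,1)`-plaquettes within `< 1` of `1`);
§3 `fluxSum_eq_zero_of_flat`, `mlog_phaseMat`, `fluxSum_unitFlux` (`= 2πi`); §4 **`no_path_from_flat_to_unitFlux`** — `N ≥ 4`: there is a `U(n)`-valued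
`N`-periodic `U` with `SmallField U (2π∕N²)` such that NO `γ : ℝ → configurations`, continuous on `[0,1]`, with every `γ τ` `N`-periodic and
`SmallField (γ τ) r` for some `r < 1`, has `γ 0` flat and `γ 1 = U`; §5 `not_uniform_radius_of_path_method` — the reading for (G1): a data radius `δ` reached
from flat data along `r`-small paths at torus size `N ≥ 4` obeys `δ < 2π∕N²`.
HONEST FRAMING (page 1): elementary topology of the abelian flux sector (the `U(1)`-factor of `U(n)`; for `SU(n)`-valued classes the analogous obstruction is
topological charge, NOT typed); a statement about continuation-from-flat METHODS (F28∕F29 shapes), not about the constrained minimisers themselves — print's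
uniform `a₁(d, L)` comes from a LOCAL existence theorem which this file does not touch; F28, F29, the road's ENDs and `hsector` are untouched; nothing of
Bałaban's asserted; NE3∕NE7 NOT proved; row NE7b (`T4WeightBudget.RelWeightBound`) NOT PRINTED ∕ NOT PROVED; spine count = dagwriter's call; finite T⁴ rung
(B)+1 — NOT infinite volume, NOT mass gap, NOT BetaPertH, NOT Clay (continuum YM on T⁴ ⇐ BetaPertH ∧ nine spine estimates).
-/

set_option autoImplicit false

open scoped BigOperators Matrix Matrix.Norms.L2Operator
open Finset NormedSpace Complex Set

namespace Summit.QuantumFields.BalabanUV.T4Continuum.NE7NearFlatSharpSector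

open Literature.MathematicalPhysics.QuantumFieldTheory.Balaban1983to89
open B7Prop1Explicit B7Prop2Explicit MatrixLog
open T4AveragingDeficitWall hiding Site Plane Plaq Bond
open T4AveragingDeficitWallBoundary (IsPeriodicCfg)
open TorusSmallFieldGlobalGaugeSharpPrep TorusSmallFieldGlobalGaugeSharp
open MinimalActionCompact (continuous_val_hol)

noncomputable section

variable {n : Type*} [Fintype n] [DecidableEq n]

/-! ## §1 The det-flux `Φ(V) = Σ_{a,b<N} tr mlog V(∂p_{(a,b,0,0)})` is in `2πi·ℤ` for periodic configurations -/

section Flux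

/-- Multiplicative telescoping for a nowhere-zero sequence: `Π_{b<N} f(b)·f(b+1)⁻¹ = f(0)·f(N)⁻¹`. [folklore] -/
theorem prod_range_mul_inv_telescope {f : ℕ → ℂ} (hf : ∀ b, f b ≠ 0) :
    ∀ N : ℕ, ∏ b ∈ Finset.range N, (f b * (f (b + 1))⁻¹) = f 0 * (f N)⁻¹
  | 0 => by rw [Finset.prod_range_zero, mul_inv_cancel₀ (hf 0)]
  | N + 1 => by
    rw [Finset.prod_range_succ, prod_range_mul_inv_telescope hf N, mul_assoc, ← mul_assoc ((f N)⁻¹), inv_mul_cancel₀ (hf N), one_mul]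

/-- THE `(0,1)`-PLAQUETTE DETERMINANT is `det V(x,0)·det V(x+e₀,1)·(det V(x+e₁,0))⁻¹·(det V(x,1))⁻¹`. [folklore] -/
theorem det_val_hol_plaqWord (V : Site 4 → Fin 4 → (Matrix n n ℂ)ˣ) (x : Site 4) :
    ((hol V x (plaqWord (0 : Fin 4) 1) : (Matrix n n ℂ)ˣ) : Matrix n n ℂ).det
      = ((V x 0 : (Matrix n n ℂ)ˣ) : Matrix n n ℂ).det * ((V (x + e 0) 1 : (Matrix n n ℂ)ˣ) : Matrix n n ℂ).det
        * (((V (x + e 1) 0 : (Matrix n n ℂ)ˣ) : Matrix n n ℂ).det)⁻¹ * (((V x 1 : (Matrix n n ℂ)ˣ) : Matrix n n ℂ).det)⁻¹ := by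
  rw [← lplaqWord_true, hol_lplaqWord, stepHol_true, stepHol_true, Letter.vec_true]
  simp only [Units.val_mul, Matrix.det_mul, det_coe_units_inv]

/-- **PERIODIC TELESCOPING**: for an `N`-periodic configuration whose `(0,1)`-plaquette variables on the slice `{(a, b, 0, 0)}` are within `< 1` of `1`,
`exp Φ(V) = Π_{a,b<N} det V(∂p) = 1`. [folklore] -/
theorem cexp_fluxSum_eq_one {N : ℕ} {V : Site 4 → Fin 4 → (Matrix n n ℂ)ˣ} (hP : IsPeriodicCfg V (N : ℤ))
    (h1 : ∀ x : Site 4, ‖((hol V x (plaqWord (0 : Fin 4) 1) : (Matrix n n ℂ)ˣ) : Matrix n n ℂ) - 1‖ < 1) :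
    cexp (∑ a ∈ Finset.range N, ∑ b ∈ Finset.range N,
      (mlog ((hol V ![(a : ℤ), (b : ℤ), 0, 0] (plaqWord (0 : Fin 4) 1) : (Matrix n n ℂ)ˣ) : Matrix n n ℂ)).trace) = 1 := by
  -- `exp (tr mlog P) = det P`
  have hdet : ∀ x : Site 4, cexp ((mlog ((hol V x (plaqWord (0 : Fin 4) 1) : (Matrix n n ℂ)ˣ) : Matrix n n ℂ)).trace)
      = ((hol V x (plaqWord (0 : Fin 4) 1) : (Matrix n n ℂ)ˣ) : Matrix n n ℂ).det := by
    intro x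
    rw [Complex.exp_eq_exp_ℂ, ← Literature.Analysis.Matrix.det_exp_eq_exp_trace, exp_mlog (h1 x)]
  set f0 : ℕ → ℕ → ℂ := fun a b => ((V ![(a : ℤ), (b : ℤ), 0, 0] 0 : (Matrix n n ℂ)ˣ) : Matrix n n ℂ).det with hf0
  set f1 : ℕ → ℕ → ℂ := fun a b => ((V ![(a : ℤ), (b : ℤ), 0, 0] 1 : (Matrix n n ℂ)ˣ) : Matrix n n ℂ).det with hf1
  have hne : ∀ (x : Site 4) (μ : Fin 4), ((V x μ : (Matrix n n ℂ)ˣ) : Matrix n n ℂ).det ≠ 0 := fun x μ =>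
    ((Matrix.isUnit_iff_isUnit_det _).mp (V x μ).isUnit).ne_zero
  have hterm : ∀ a b : ℕ, ((hol V ![(a : ℤ), (b : ℤ), 0, 0] (plaqWord (0 : Fin 4) 1) : (Matrix n n ℂ)ˣ) : Matrix n n ℂ).det
      = (f0 a b * (f0 a (b + 1))⁻¹) * (f1 (a + 1) b * (f1 a b)⁻¹) := by
    intro a b
    rw [det_val_hol_plaqWord, (slice_shifts (a : ℤ) (b : ℤ) 0).1, (slice_shifts (a : ℤ) (b : ℤ) 0).2.1]
    simp only [hf0, hf1]
    push_cast
    ring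
  -- periodicity in `b` (direction 1) and in `a` (direction 0)
  have hper0 : ∀ a : ℕ, f0 a N = f0 a 0 := by
    intro a
    simp only [hf0]
    rw [← hP ![(a : ℤ), ((0 : ℕ) : ℤ), 0, 0] 1 0, (slice_shifts (a : ℤ) ((0 : ℕ) : ℤ) (N : ℤ)).2.2.2]
    push_cast; rw [zero_add]
  have hper1 : ∀ b : ℕ, f1 N b = f1 0 b := by
    intro b
    simp only [hf1]
    rw [← hP ![((0 : ℕ) : ℤ), (b : ℤ), 0, 0] 0 1, (slice_shifts ((0 : ℕ) : ℤ) (b : ℤ) (N : ℤ)).2.2.1]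
    push_cast; rw [zero_add]
  rw [Complex.exp_sum]
  simp_rw [Complex.exp_sum, hdet, hterm]
  have hA : ∀ a ∈ Finset.range N, ∏ b ∈ Finset.range N, (f0 a b * (f0 a (b + 1))⁻¹) = 1 := by
    intro a _
    have h := prod_range_mul_inv_telescope (f := f0 a) (fun b => hne _ _) N
    rw [h, hper0, mul_inv_cancel₀ (hne _ _)]
  have hB : ∀ b ∈ Finset.range N, ∏ a ∈ Finset.range N, (f1 (a + 1) b * (f1 a b)⁻¹) = 1 := by
    intro b _
    have h := prod_range_mul_inv_telescope (f := fun a => (f1 a b)⁻¹) (fun a => inv_ne_zero (hne _ _)) N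
    simp only [inv_inv] at h
    rw [Finset.prod_congr rfl (fun a _ => mul_comm (f1 (a + 1) b) ((f1 a b)⁻¹)), h, hper1, inv_mul_cancel₀ (hne _ _)]
  have e1 : ∀ a ∈ Finset.range N, ∏ b ∈ Finset.range N, (f0 a b * (f0 a (b + 1))⁻¹ * (f1 (a + 1) b * (f1 a b)⁻¹))
      = ∏ b ∈ Finset.range N, (f1 (a + 1) b * (f1 a b)⁻¹) := by
    intro a ha
    rw [Finset.prod_mul_distrib, hA a ha, one_mul]
  rw [Finset.prod_congr rfl e1, Finset.prod_comm]
  exact Finset.prod_eq_one hB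

/-- Hence `Φ(V) ∈ 2πi·ℤ`. [folklore] -/
theorem fluxSum_mem_zmultiples {N : ℕ} {V : Site 4 → Fin 4 → (Matrix n n ℂ)ˣ} (hP : IsPeriodicCfg V (N : ℤ))
    (h1 : ∀ x : Site 4, ‖((hol V x (plaqWord (0 : Fin 4) 1) : (Matrix n n ℂ)ˣ) : Matrix n n ℂ) - 1‖ < 1) :
    ∃ k : ℤ, (∑ a ∈ Finset.range N, ∑ b ∈ Finset.range N,
      (mlog ((hol V ![(a : ℤ), (b : ℤ), 0, 0] (plaqWord (0 : Fin 4) 1) : (Matrix n n ℂ)ˣ) : Matrix n n ℂ)).trace) = k * (2 * Real.pi * I) :=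
  Complex.exp_eq_one_iff.mp (cexp_fluxSum_eq_one hP h1)

end Flux

/-! ## §2 Continuity of `Φ` along a path whose `(0,1)`-plaquettes stay within `< 1` of `1` -/

section Cont

/-- `Φ ∘ γ` is continuous on `[0,1]`. [folklore] -/
theorem continuousOn_fluxSum (N : ℕ) {γ : ℝ → (Site 4 → Fin 4 → (Matrix n n ℂ)ˣ)} (hγc : ContinuousOn γ (Icc (0 : ℝ) 1))
    (h1 : ∀ τ ∈ Icc (0 : ℝ) 1, ∀ x : Site 4, ‖((hol (γ τ) x (plaqWord (0 : Fin 4) 1) : (Matrix n n ℂ)ˣ) : Matrix n n ℂ) - 1‖ < 1) :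
    ContinuousOn (fun τ => ∑ a ∈ Finset.range N, ∑ b ∈ Finset.range N,
      (mlog ((hol (γ τ) ![(a : ℤ), (b : ℤ), 0, 0] (plaqWord (0 : Fin 4) 1) : (Matrix n n ℂ)ˣ) : Matrix n n ℂ)).trace) (Icc (0 : ℝ) 1) := by
  refine continuousOn_finsetSum _ fun a _ => continuousOn_finsetSum _ fun b _ => ?_
  intro τ hτ
  have htr : Continuous fun X : Matrix n n ℂ => X.trace := continuous_id.matrix_trace
  have hin : ContinuousWithinAt (fun τ => ((hol (γ τ) ![(a : ℤ), (b : ℤ), 0, 0] (plaqWord (0 : Fin 4) 1) : (Matrix n n ℂ)ˣ) : Matrix n n ℂ))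
      (Icc (0 : ℝ) 1) τ :=
    (continuous_val_hol (n := n) (![(a : ℤ), (b : ℤ), 0, 0] : Site 4) (plaqWord (0 : Fin 4) 1)).continuousAt.comp_continuousWithinAt (hγc τ hτ)
  have hml : ContinuousAt (fun X : Matrix n n ℂ => (mlog X).trace)
      (((hol (γ τ) ![(a : ℤ), (b : ℤ), 0, 0] (plaqWord (0 : Fin 4) 1) : (Matrix n n ℂ)ˣ) : Matrix n n ℂ)) :=
    htr.continuousAt.comp (analyticAt_mlog (h1 τ hτ _)).continuousAt
  exact ContinuousAt.comp_continuousWithinAt (g := fun X : Matrix n n ℂ => (mlog X).trace)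
    (f := fun τ => ((hol (γ τ) ![(a : ℤ), (b : ℤ), 0, 0] (plaqWord (0 : Fin 4) 1) : (Matrix n n ℂ)ˣ) : Matrix n n ℂ)) hml hin

end Cont

/-! ## §3 The values of `Φ`: `0` at a flat configuration, `2πi` at the unit-flux configuration -/

section Values

/-- `Φ = 0` at a configuration whose `(0,1)`-plaquette variables are `1`. [folklore] -/
theorem fluxSum_eq_zero_of_flat (N : ℕ) {F : Site 4 → Fin 4 → (Matrix n n ℂ)ˣ} (hflat : ∀ x : Site 4, hol F x (plaqWord (0 : Fin 4) 1) = 1) :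
    (∑ a ∈ Finset.range N, ∑ b ∈ Finset.range N,
      (mlog ((hol F ![(a : ℤ), (b : ℤ), 0, 0] (plaqWord (0 : Fin 4) 1) : (Matrix n n ℂ)ˣ) : Matrix n n ℂ)).trace) = 0 := by
  refine Finset.sum_eq_zero fun a _ => Finset.sum_eq_zero fun b _ => ?_
  rw [hflat, Units.val_one, mlog_one, Matrix.trace_zero]

/-- `mlog D(e^{iα}) = diag(0, …, iα, …, 0)` for `|α| < log 2`, hence `tr mlog D(e^{iα}) = iα`. [folklore] -/
theorem trace_mlog_phaseMat (i₀ : n) {α : ℝ} (hα : |α| < Real.log 2) :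
    (mlog (Matrix.diagonal (Function.update (1 : n → ℂ) i₀ (cexp (I * α))))).trace = I * α := by
  have hexp : Matrix.diagonal (Function.update (1 : n → ℂ) i₀ (cexp (I * α))) = exp (Matrix.diagonal (Function.update (0 : n → ℂ) i₀ (I * α))) := by
    rw [Matrix.exp_diagonal, Pi.exp_def]
    congr 1
    funext j
    by_cases hj : j = i₀
    · subst hj; rw [Function.update_self, Function.update_self, Complex.exp_eq_exp_ℂ]
    · rw [Function.update_of_ne hj, Function.update_of_ne hj, Pi.one_apply, Pi.zero_apply, NormedSpace.exp_zero]
  have hnorm : ‖Matrix.diagonal (Function.update (0 : n → ℂ) i₀ (I * α))‖ < Real.log 2 := by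
    rw [Matrix.l2_opNorm_diagonal]
    refine lt_of_le_of_lt ((pi_norm_le_iff_of_nonneg (abs_nonneg α)).mpr fun j => ?_) hα
    by_cases hj : j = i₀
    · subst hj; rw [Function.update_self, norm_mul, Complex.norm_I, one_mul, Complex.norm_real, Real.norm_eq_abs]
    · rw [Function.update_of_ne hj, Pi.zero_apply, norm_zero]; exact abs_nonneg α
  rw [hexp, B7BlockAvgLog.mlog_exp hnorm, Matrix.trace_diagonal, Finset.sum_update_of_mem (Finset.mem_univ _)]
  simp

variable {N : ℕ} {θ : Site 4 → Fin 4 → ℝ}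
  (hθ0 : ∀ x : Site 4, θ x 0 = if x 0 % (N : ℤ) = (N : ℤ) - 1 then -(2 * Real.pi * ((x 1 : ℤ) : ℝ) / (N : ℝ)) else 0)
  (hθ1 : ∀ x : Site 4, θ x 1 = 2 * Real.pi * (((x 0 % (N : ℤ) : ℤ)) : ℝ) / (N : ℝ) ^ 2)
  {i₀ : n} {U : Site 4 → Fin 4 → (Matrix n n ℂ)ˣ}
  (hU : ∀ x μ, ((U x μ : (Matrix n n ℂ)ˣ) : Matrix n n ℂ) = Matrix.diagonal (Function.update (1 : n → ℂ) i₀ (cexp (I * θ x μ))))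
include hθ0 hθ1 hU

/-- **`Φ = 2πi` AT THE UNIT-FLUX CONFIGURATION** (`N ≥ 4`, so that `2π∕N² < log 2`): every `(0,1)`-plaquette variable is `D(e^{2πi∕N²})` with
`tr mlog = 2πi∕N²`, and there are `N²` of them on the slice. [folklore] -/
theorem fluxSum_unitFlux (hN : 4 ≤ N) :
    (∑ a ∈ Finset.range N, ∑ b ∈ Finset.range N,
      (mlog ((hol U ![(a : ℤ), (b : ℤ), 0, 0] (plaqWord (0 : Fin 4) 1) : (Matrix n n ℂ)ˣ) : Matrix n n ℂ)).trace) = 2 * Real.pi * I := by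
  have hN1 : 1 ≤ N := le_trans (by norm_num) hN
  have hNr : (4 : ℝ) ≤ N := by exact_mod_cast hN
  have hα : |2 * Real.pi / (N : ℝ) ^ 2| < Real.log 2 := by
    rw [abs_of_nonneg (by positivity)]
    have h16 : (16 : ℝ) ≤ (N : ℝ) ^ 2 := by nlinarith
    have hπ := Real.pi_lt_four
    have hl := Real.log_two_gt_d9
    rw [div_lt_iff₀ (by positivity)]
    nlinarith
  have hplaq : ∀ x : Site 4, (mlog ((hol U x (plaqWord (0 : Fin 4) 1) : (Matrix n n ℂ)ˣ) : Matrix n n ℂ)).trace = I * ((2 * Real.pi / (N : ℝ) ^ 2 : ℝ) : ℂ) := by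
    intro x
    rw [val_hol_plaqWord_of_phaseCfg hU, plaqPhase_zero_one hθ0 hθ1 hN1 x, trace_mlog_phaseMat i₀ hα]
  simp_rw [hplaq, Finset.sum_const, Finset.card_range, nsmul_eq_mul]
  have hN0 : (N : ℂ) ≠ 0 := by exact_mod_cast (by omega : N ≠ 0)
  push_cast
  field_simp

end Values

/-! ## §4 THE OBSTRUCTION: no small-curvature path from a flat datum to the unit-flux datum -/

section Obstruction

variable [Nonempty n]

/-- **THE FLUX SECTOR SEPARATES THE SMALL CLASS FROM THE FLAT DATA ALONG PATHS.**  For `N ≥ 4` there is a `U(n)`-valued `N`-periodic configuration `U` on `ℤ⁴`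
with `SmallField U (2π∕N²)` (gen 156's unit-flux configuration) such that: for every `r < 1` there is NO map `γ : ℝ → configurations`, continuous on `[0, 1]`
(product topology), with every `γ τ` (`τ ∈ [0,1]`) `N`-periodic and `SmallField (γ τ) r`, `γ 0` flat (all plaquette variables `1`) and `γ 1 = U`.  Unitarity
along the path is not needed. [folklore] -/
theorem no_path_from_flat_to_unitFlux {N : ℕ} (hN : 4 ≤ N) :
    ∃ U : Site 4 → Fin 4 → (Matrix n n ℂ)ˣ, IsUnitaryCfg U ∧ IsPeriodicCfg U (N : ℤ) ∧ SmallField U (2 * Real.pi / (N : ℝ) ^ 2) ∧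
      ∀ r : ℝ, r < 1 → ∀ γ : ℝ → (Site 4 → Fin 4 → (Matrix n n ℂ)ˣ), ContinuousOn γ (Icc (0 : ℝ) 1) →
        (∀ τ ∈ Icc (0 : ℝ) 1, IsPeriodicCfg (γ τ) (N : ℤ)) → (∀ τ ∈ Icc (0 : ℝ) 1, SmallField (γ τ) r) →
        (∀ (x : Site 4) (κ μ : Fin 4), κ ≠ μ → hol (γ 0) x (plaqWord κ μ) = 1) → γ 1 ≠ U := by
  obtain ⟨i₀⟩ := ‹Nonempty n›
  have hN1 : 1 ≤ N := le_trans (by norm_num) hN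
  -- gen 156's unit-flux configuration
  let θ : Site 4 → Fin 4 → ℝ := fun x μ =>
    if μ = 0 then (if x 0 % (N : ℤ) = (N : ℤ) - 1 then -(2 * Real.pi * ((x 1 : ℤ) : ℝ) / (N : ℝ)) else 0)
    else if μ = 1 then 2 * Real.pi * (((x 0 % (N : ℤ) : ℤ)) : ℝ) / (N : ℝ) ^ 2 else 0
  have hθ0 : ∀ x : Site 4, θ x 0 = if x 0 % (N : ℤ) = (N : ℤ) - 1 then -(2 * Real.pi * ((x 1 : ℤ) : ℝ) / (N : ℝ)) else 0 :=
    fun x => by simp [θ]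
  have hθ1 : ∀ x : Site 4, θ x 1 = 2 * Real.pi * (((x 0 % (N : ℤ) : ℤ)) : ℝ) / (N : ℝ) ^ 2 := fun x => by simp [θ]
  have hθ2 : ∀ x : Site 4, θ x 2 = 0 := fun x => by simp [θ]
  have hθ3 : ∀ x : Site 4, θ x 3 = 0 := fun x => by simp [θ]
  let U : Site 4 → Fin 4 → (Matrix n n ℂ)ˣ := fun x μ =>
    ⟨Matrix.diagonal (Function.update (1 : n → ℂ) i₀ (cexp (I * θ x μ))),
      Matrix.diagonal (Function.update (1 : n → ℂ) i₀ (cexp (I * θ x μ))⁻¹),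
      by rw [phaseMat_mul, mul_inv_cancel₀ (Complex.exp_ne_zero _), phaseMat_one],
      by rw [phaseMat_mul, inv_mul_cancel₀ (Complex.exp_ne_zero _), phaseMat_one]⟩
  have hU : ∀ x μ, ((U x μ : (Matrix n n ℂ)ˣ) : Matrix n n ℂ) = Matrix.diagonal (Function.update (1 : n → ℂ) i₀ (cexp (I * θ x μ))) :=
    fun _ _ => rfl
  refine ⟨U, isUnitaryCfg_of_phaseCfg hU, isPeriodicCfg_unitFlux hθ0 hθ1 hθ2 hθ3 hU hN1, smallField_unitFlux hθ0 hθ1 hθ2 hθ3 hU hN1, ?_⟩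
  intro r hr γ hγc hγP hγs hflat hend
  -- the `(0,1)`-plaquettes along the path are within `< 1` of `1`
  have h1 : ∀ τ ∈ Icc (0 : ℝ) 1, ∀ x : Site 4, ‖((hol (γ τ) x (plaqWord (0 : Fin 4) 1) : (Matrix n n ℂ)ˣ) : Matrix n n ℂ) - 1‖ < 1 :=
    fun τ hτ x => (hγs τ hτ x 0 1 zero_ne_one).trans_lt hr
  -- the normalised flux `g(τ) = Im Φ(γ τ) ∕ 2π` is continuous, integer-valued, `g(0) = 0`, `g(1) = 1`
  set Φ : ℝ → ℂ := fun τ => ∑ a ∈ Finset.range N, ∑ b ∈ Finset.range N,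
    (mlog ((hol (γ τ) ![(a : ℤ), (b : ℤ), 0, 0] (plaqWord (0 : Fin 4) 1) : (Matrix n n ℂ)ˣ) : Matrix n n ℂ)).trace with hΦ
  set g : ℝ → ℝ := fun τ => (Φ τ).im / (2 * Real.pi) with hg
  have hgc : ContinuousOn g (Icc (0 : ℝ) 1) :=
    ((Complex.continuous_im.comp_continuousOn (continuousOn_fluxSum N hγc h1)).div_const _)
  have hgint : ∀ τ ∈ Icc (0 : ℝ) 1, ∃ k : ℤ, g τ = k := by
    intro τ hτ
    obtain ⟨k, hk⟩ := fluxSum_mem_zmultiples (hγP τ hτ) (h1 τ hτ)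
    refine ⟨k, ?_⟩
    simp only [hg, hΦ] at hk ⊢
    rw [hk]
    simp [Complex.mul_im, Real.pi_pos.ne']
  have hg0 : g 0 = 0 := by
    simp only [hg, hΦ]
    rw [fluxSum_eq_zero_of_flat N fun x => hflat x 0 1 zero_ne_one, Complex.zero_im, zero_div]
  have hg1 : g 1 = 1 := by
    simp only [hg, hΦ]
    rw [hend, fluxSum_unitFlux hθ0 hθ1 hU hN]
    simp [Complex.mul_im, Real.pi_pos.ne']
  -- intermediate value `1∕2`
  have hmem : (1 / 2 : ℝ) ∈ Icc (g 0) (g 1) := by rw [hg0, hg1]; constructor <;> norm_num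
  obtain ⟨τ, hτ, hτv⟩ := intermediate_value_Icc zero_le_one hgc hmem
  obtain ⟨k, hk⟩ := hgint τ hτ
  rw [hk] at hτv
  have h2 : (2 * k : ℤ) = 1 := by exact_mod_cast (by linarith : (2 : ℝ) * k = 1)
  omega

/-- **THE READING FOR (G1).**  Any data radius `δ` at torus size `N ≥ 4` that a continuation-from-flat method reaches ALONG `r`-SMALL PATHS (`r < 1`) — i.e. every
`U(n)`-valued `N`-periodic `V` with `SmallField V δ` is the endpoint of a path of `N`-periodic, `r`-small configurations, continuous on `[0,1]`, from a flat
configuration (the shape consumed by F28 `oneStep_of_path_ape_repWgauge`; F29's «near flat + chord» is one instance) — obeys `δ < 2π∕N²`.  Uniformity of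
`δ_V` in the torus size is therefore outside every such method for `U(n)`. [folklore] -/
theorem not_uniform_radius_of_path_method {N : ℕ} (hN : 4 ≤ N) {δ r : ℝ} (hr : r < 1)
    (hpath : ∀ V : Site 4 → Fin 4 → (Matrix n n ℂ)ˣ, IsUnitaryCfg V → IsPeriodicCfg V (N : ℤ) → SmallField V δ →
      ∃ γ : ℝ → (Site 4 → Fin 4 → (Matrix n n ℂ)ˣ), ContinuousOn γ (Icc (0 : ℝ) 1) ∧ (∀ τ ∈ Icc (0 : ℝ) 1, IsPeriodicCfg (γ τ) (N : ℤ)) ∧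
        (∀ τ ∈ Icc (0 : ℝ) 1, SmallField (γ τ) r) ∧ (∀ (x : Site 4) (κ μ : Fin 4), κ ≠ μ → hol (γ 0) x (plaqWord κ μ) = 1) ∧ γ 1 = V) :
    δ < 2 * Real.pi / (N : ℝ) ^ 2 := by
  by_contra hδ
  push Not at hδ
  obtain ⟨U, hUu, hUP, hUs, hno⟩ := no_path_from_flat_to_unitFlux (n := n) hN
  obtain ⟨γ, hγc, hγP, hγs, hflat, hend⟩ := hpath U hUu hUP (MinimalActionRate.SmallField.mono hUs hδ)
  exact hno r hr γ hγc hγP hγs hflat hend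

end Obstruction

end

end Summit.QuantumFields.BalabanUV.T4Continuum.NE7NearFlatSharpSector
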